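import Summits.HubbardSuperconductivity.HubbardSuperconductivity.Theorems.NodalWardXYPerturbedXYOrderMeanFieldBounds

/-!
# Crux `PerturbedXYOrder` (stmt-HubbardSuperconductivity-10739): among O(2)-INVARIANT tilts, spatial decay is load-bearing —
# the invariant mean-field source `s|M|²/N` is NOT uniformly zero-free (Goldstone pinching; lead c19, line `schwarz-inheritance`,
# registered stub `stub_invariantMeanFieldPinching`)

The crux `Theses.NodalWardXY.PerturbedXYOrder` asks for uniform-in-`L` zero-freeness (and order) of the low-temperature rotator on
`(ℤ/Lℤ)³` tilted by `e^{W_K}`, `W_K = Σ K(b,b') j_b j_{b'}` an O(2)-invariant complex two-current perturbation with `(1+dist)⁻⁴` kernel,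
`‖W_K‖ ≤ CεL³`.  The landed negatives certify three typed edges: low temperature (`perturbedXYOrder_false_without_lowT`, p73198), the decay
exponent from below (`perturbedXYOrder_false_with_exponent_three`, p122024 — an ultraviolet/energetic instability: log-divergent row sums
overwhelm `J`) and O(2)-INVARIANCE (`perturbedXYOrder_false_for_charged_field` p151347, `…_for_charged_energy_tilt` p153499 — Lee–Yang
pinching by the magnetisation).  This file proves a fourth, with a NEW, INFRARED mechanism that applies to INVARIANT sources:

  `¬ ∃ J₀ ε > 0, ∀ J ≥ J₀, ∀ L ≥ 2, ∀ s ∈ ℂ, ‖s‖ ≤ ε → ∫_cube w_J e^{(s/L³) Σ_{x,y} cos(θ_x − θ_y)} dθ ≠ 0`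

(`perturbedXYOrder_false_for_invariant_meanField_source`, alias of the registered stub `stub_invariantMeanFieldPinching`).  The tilt
`W = (s/L³) Σ_{x,y} cos(θ_x − θ_y) = s L³ |m_L|²` is O(2)-invariant, bounded by `|s| L³` (the size of an admissible `W_K`), a pair interaction
of per-site `ℓ¹`-strength `|s|` — but with NO spatial decay.  So: invariance + smallness + summability do not suffice; among invariant tilts
the DECAY of the kernel is load-bearing (the crux strategist's census rated "all invariant summable perturbations" plausible, STRATEGY-CENSUS
§Strengthen S3), and the "observable-as-source" softening of the plateau half (§Decomposition D7: source the plateau observable `|m_L|²`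
itself) is false, with zero-free radius `O(J/(a₀² L²))` exactly as D7's Gaussian caricature predicted.  Positive shadow for engine design:
what decouples an admissible `W_K` from the Goldstone twist is its two-CURRENT (lattice-gradient) structure, not its invariance alone.

Proof (all inputs in the tree; tools in `Theorems/NodalWardXYPerturbedXYOrderTwistBound.lean`, `…CharacterSum.lean`,
`…MeanFieldBounds.lean`).
* UPPER bound — complex analysis (`cfp_log_norm_le_of_zeroFree`, p151006): `G(s) = Z(s)Z(−s)/Z(0)²` is entire, EVEN (so `G'(0) = 0`
  without any symmetry of the model), zero-free on `‖s‖ < ε` under the hypothesis, and `‖G‖ ≤ e^{2εL³}`; hence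
  `log ‖G(σ)‖ ≤ 16 L³ σ²/ε` for `0 < σ < ε/2`.
* LOWER bound, `s = +σ` — Jensen and long-range order (`realPlateau`, p86048): `log Z(σ)/Z(0) ≥ σ L³ Re cratio ≥ σ a₀ L³`.
* LOWER bound, `s = −σ` — the TWISTED Gibbs variational principle (`gp_twisted_jensen_symm`): rotating the trial state by the Mermin–Wagner
  twist `g_k = 2πk x₀/L` costs only `J Σ_b (1 − cos ∇_b g_k) = JL³(1 − cos 2πk/L) ≤ 2π²k²JL`, and turns the source into
  `−(σ/L³)|M_k|²`-type terms whose SUM over all wave numbers is `≤ σL³` by orthogonality of the characters of `ℤ/Lℤ` (`gp_charSum_bound`);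
  averaging over `k = 1,…,m`: `log Z(−σ)/Z(0) ≥ −σL³/m − 2π²m²JL`.  With `m = ⌈2/a₀⌉` the sum of the two lower bounds is
  `≥ σ a₀ L³/2 − 2π² m² J L` — linear in `σ` with a POSITIVE slope on both sides of `0`: a cusp as `L → ∞`.
* At `σ = a₀ε/64`: `L³ a₀² ε/256 ≤ 2π² m² J L`, i.e. `L² ≤ 512 π² m² J/(a₀² ε)` — false for large `L`.
-/

noncomputable section

namespace Summit.HubbardSuperconductivity.HubbardSuperconductivity.Theorems.PerturbedXYOrder

open MeasureTheory Literature.Probability.LatticeModels Metric Set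
open Summit.HubbardSuperconductivity.HubbardSuperconductivity.Theses.NodalWardXY

variable {L : ℕ}

/-- For real `t` the mean-field-tilted partition function is the real integral `∫ e^{t S/L³} w_J`. -/
theorem gp_Zmf_real [NeZero L] (J t : ℝ) :
    (∫ θ in cube L, wJ J θ * Complex.exp ((t : ℂ) * ((∑ x : TorusSite 3 L, ∑ y : TorusSite 3 L,
        (Real.cos (θ x - θ y) : ℂ)) / (L : ℂ) ^ 3))) =
      ((∫ θ in cube L, Real.exp (t * ((∑ x : TorusSite 3 L, ∑ y : TorusSite 3 L, Real.cos (θ x - θ y)) / (L : ℝ) ^ 3)) *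
        (wJ J θ).re : ℝ) : ℂ) := by
  rw [← integral_complex_ofReal]
  refine integral_congr_ae (ae_of_all _ fun θ => ?_)
  dsimp only
  rw [gp_wJ_re]
  unfold wJ
  have : (t : ℂ) * ((∑ x : TorusSite 3 L, ∑ y : TorusSite 3 L, (Real.cos (θ x - θ y) : ℂ)) / (L : ℂ) ^ 3) =
      ((t * ((∑ x : TorusSite 3 L, ∑ y : TorusSite 3 L, Real.cos (θ x - θ y)) / (L : ℝ) ^ 3) : ℝ) : ℂ) := by
    push_cast; ring
  rw [this, ← Complex.ofReal_exp]
  push_cast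
  ring

/-- `‖Σ_{x,y} cos(θ_x − θ_y) / L³‖ ≤ L³` (as a complex number). -/
theorem gp_norm_source_le [NeZero L] (θ : TorusSite 3 L → ℝ) :
    ‖(∑ x : TorusSite 3 L, ∑ y : TorusSite 3 L, (Real.cos (θ x - θ y) : ℂ)) / (L : ℂ) ^ 3‖ ≤ (L : ℝ) ^ 3 := by
  have hL0 : (0 : ℝ) < L := by have := NeZero.pos L; exact_mod_cast this
  have hL3 : ‖((L : ℂ)) ^ 3‖ = (L : ℝ) ^ 3 := by simp
  rw [norm_div, hL3, div_le_iff₀ (by positivity)]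
  calc ‖∑ x : TorusSite 3 L, ∑ y : TorusSite 3 L, (Real.cos (θ x - θ y) : ℂ)‖
      ≤ ∑ x : TorusSite 3 L, ‖∑ y : TorusSite 3 L, (Real.cos (θ x - θ y) : ℂ)‖ := norm_sum_le _ _
    _ ≤ ∑ x : TorusSite 3 L, ∑ y : TorusSite 3 L, ‖(Real.cos (θ x - θ y) : ℂ)‖ :=
        Finset.sum_le_sum fun x _ => norm_sum_le _ _
    _ ≤ ∑ _x : TorusSite 3 L, ∑ _y : TorusSite 3 L, (1 : ℝ) := by
        gcongr with x _ y _
        rw [Complex.norm_real, Real.norm_eq_abs]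
        exact Real.abs_cos_le_one _
    _ = (L : ℝ) ^ 3 * (L : ℝ) ^ 3 := by
        simp only [Finset.sum_const, Finset.card_univ, nsmul_eq_mul, mul_one, cfp_card]

/-- **Growth** of the mean-field-tilted partition function: `‖Z(s)‖ ≤ e^{‖s‖ L³} Z(0)`. -/
theorem gp_norm_Zmf_le [NeZero L] (J : ℝ) (s : ℂ) :
    ‖∫ θ in cube L, wJ J θ * Complex.exp (s * ((∑ x : TorusSite 3 L, ∑ y : TorusSite 3 L,
        (Real.cos (θ x - θ y) : ℂ)) / (L : ℂ) ^ 3))‖ ≤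
      Real.exp (‖s‖ * (L : ℝ) ^ 3) * ∫ θ in cube L, (wJ J θ).re := by
  rw [← integral_const_mul]
  refine norm_integral_le_of_norm_le ((gp_integrable (gp_continuous_wJ_re J)).const_mul _) (ae_of_all _ fun θ => ?_)
  rw [norm_mul]
  have hw : ‖wJ J θ‖ = (wJ J θ).re := by
    rw [gp_wJ_re]; unfold wJ; rw [Complex.norm_real, Real.norm_eq_abs, Real.abs_exp]
  rw [hw, mul_comm]
  refine mul_le_mul_of_nonneg_right ?_ (gp_wJ_re_pos J θ).le
  refine (Complex.norm_exp_le_exp_norm _).trans (Real.exp_le_exp.2 ?_)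
  rw [norm_mul]
  exact mul_le_mul_of_nonneg_left (gp_norm_source_le θ) (norm_nonneg _)

/-- **Goldstone pinching — the O(2)-invariant mean-field source is NOT uniformly zero-free** (registered stub
`stub_invariantMeanFieldPinching` of the line `schwarz-inheritance`, lead c19).  For the low-temperature rotator on `(ℤ/Lℤ)³` tilted by the
INVARIANT, bounded (`‖W‖ ≤ |s| L³`), per-site-`ℓ¹`-summable pair source `W = (s/L³) Σ_{x,y} cos(θ_x − θ_y) = s L³ |m_L|²`,

  `¬ ∃ J₀ ε > 0, ∀ J ≥ J₀, ∀ L ≥ 2, ∀ s ∈ ℂ, ‖s‖ ≤ ε → ∫_cube w_J e^{(s/L³) Σ_{x,y} cos(θ_x − θ_y)} dθ ≠ 0`.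

Proof.  Fix `J = max(J₀, J₁, 0)` with `J₁, a₀` from `realPlateau`, `m = ⌈2/a₀⌉`, and a large `L`.  `G(s) = Z(s)Z(−s)/Z(0)²` is entire,
even, zero-free on `‖s‖ < ε` and `‖G‖ ≤ e^{2εL³}` there, so `log ‖G(σ)‖ ≤ 16 L³ σ²/ε` for `0 < σ < ε/2` (`cfp_log_norm_le_of_zeroFree`).
From below, Jensen gives `log Z(σ)/Z(0) ≥ σ a₀ L³` (long-range order) and the TWISTED Jensen bound — the Mermin–Wagner twists
`g_k = 2πk x₀/L`, `k ≤ m`, as trial states, cost `≤ 2π²m²JL` each, twisted magnetisations `Σ_{k<L} |M_k|² ≤ L⁶` by orthogonality of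
characters — gives `log Z(−σ)/Z(0) ≥ −σL³/m − 2π²m²JL`; so `log ‖G(σ)‖ ≥ σ a₀ L³/2 − 2π²m²JL`: a cusp at `s = 0` as `L → ∞`.  At
`σ = a₀ε/64` the two bounds force `L² ≤ 512π²m²J/(a₀²ε)`.  Hence, after low temperature (p73198), the decay exponent (p122024) and
invariance (p151347, p153499), a fourth typed edge of `PerturbedXYOrder`: among INVARIANT tilts, spatial DECAY of the kernel — not mere
summability — is load-bearing; the observable-as-source softening of the plateau half (STRATEGY-CENSUS D7) is false, with zero-free
radius `O(J/(a₀² L²))` as predicted there. -/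
theorem stub_invariantMeanFieldPinching :
    ¬ (∃ J₀ ε : ℝ, 0 < ε ∧ ∀ J : ℝ, J₀ ≤ J → ∀ (L : ℕ) [NeZero L], 2 ≤ L →
        ∀ s : ℂ, ‖s‖ ≤ ε →
          (∫ θ in cube L, wJ J θ * Complex.exp (s * ((∑ x : TorusSite 3 L, ∑ y : TorusSite 3 L,
            (Real.cos (θ x - θ y) : ℂ)) / (L : ℂ) ^ 3))) ≠ 0) := by
  rintro ⟨J₀, ε, hε, h⟩
  obtain ⟨J₁, a₀, ha₀, hplat⟩ := realPlateau
  set J : ℝ := max (max J₀ J₁) 0 with hJ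
  have hJ0 : 0 ≤ J := le_max_right _ _
  have hJJ₀ : J₀ ≤ J := (le_max_left _ _).trans (le_max_left _ _)
  have hJJ₁ : J₁ ≤ J := (le_max_right _ _).trans (le_max_left _ _)
  -- the number of twists
  set m : ℕ := ⌈2 / a₀⌉₊ with hmdef
  have hm1 : 1 ≤ m := Nat.one_le_iff_ne_zero.2 (Nat.pos_iff_ne_zero.1 (Nat.ceil_pos.2 (by positivity)))
  have hma : 2 / a₀ ≤ m := Nat.le_ceil _
  have hm0 : (0 : ℝ) < m := by exact_mod_cast hm1
  -- the volume
  set B : ℝ := 512 * Real.pi ^ 2 * (m : ℝ) ^ 2 * J / (a₀ ^ 2 * ε) with hB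
  have hB0 : 0 ≤ B := by positivity
  set L : ℕ := max (m + 1) (⌈B⌉₊ + 2) with hLdef
  have hL2 : 2 ≤ L := le_trans (by omega) (le_max_right _ _)
  have hmL : m < L := lt_of_lt_of_le (Nat.lt_succ_self m) (le_max_left _ _)
  haveI : NeZero L := ⟨by omega⟩
  have hL2r : (2 : ℝ) ≤ L := by exact_mod_cast hL2
  have hBL : B < L := by
    have h1 : (⌈B⌉₊ + 2 : ℕ) ≤ L := le_max_right _ _
    have h2 : ((⌈B⌉₊ + 2 : ℕ) : ℝ) ≤ (L : ℝ) := by exact_mod_cast h1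
    push_cast at h2
    linarith [Nat.le_ceil B]
  have hBL2 : B < (L : ℝ) ^ 2 := by nlinarith
  set N : ℝ := (L : ℝ) ^ 3 with hN
  have hNpos : 0 < N := by positivity
  -- the plateau at `(J, L)`
  obtain ⟨hpl, hn1⟩ := hplat J hJJ₁ L hL2
  have ha1 : a₀ ≤ 1 := hpl.trans ((Complex.re_le_norm _).trans hn1)
  -- the mean-field-tilted partition function and its real version
  set Zs : ℂ → ℂ := fun s => ∫ θ in cube L, wJ J θ * Complex.exp (s * ((∑ x : TorusSite 3 L, ∑ y : TorusSite 3 L,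
    (Real.cos (θ x - θ y) : ℂ)) / (L : ℂ) ^ 3)) with hZs
  set Zr : ℝ → ℝ := fun t => ∫ θ in cube L, Real.exp (t * ((∑ x : TorusSite 3 L, ∑ y : TorusSite 3 L,
    Real.cos (θ x - θ y)) / (L : ℝ) ^ 3)) * (wJ J θ).re with hZr
  set Z₀ : ℝ := ∫ θ in cube L, (wJ J θ).re with hZ₀
  have hZ₀pos : 0 < Z₀ := gp_integral_wJ_re_pos J
  have hreal : ∀ t : ℝ, Zs t = ((Zr t : ℝ) : ℂ) := fun t => gp_Zmf_real J t
  have hZr0 : Zr 0 = Z₀ := by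
    simp only [hZr, hZ₀, zero_mul, Real.exp_zero, one_mul]
  have hZs0 : Zs 0 = ((Z₀ : ℝ) : ℂ) := by
    have := hreal 0
    rw [Complex.ofReal_zero] at this
    rw [this, hZr0]
  have hZs0_ne : Zs 0 ≠ 0 := by rw [hZs0, Ne, Complex.ofReal_eq_zero]; exact hZ₀pos.ne'
  have hZrpos : ∀ t : ℝ, 0 < Zr t := by
    intro t
    simp only [hZr]
    have hc : Continuous fun θ : TorusSite 3 L → ℝ => Real.exp (t * ((∑ x : TorusSite 3 L, ∑ y : TorusSite 3 L,
        Real.cos (θ x - θ y)) / (L : ℝ) ^ 3)) * (wJ J θ).re :=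
      (by fun_prop : Continuous fun θ : TorusSite 3 L → ℝ => Real.exp (t * ((∑ x : TorusSite 3 L, ∑ y : TorusSite 3 L,
        Real.cos (θ x - θ y)) / (L : ℝ) ^ 3))).mul (gp_continuous_wJ_re J)
    have hint := gp_integrable (L := L) hc
    rw [integral_pos_iff_support_of_nonneg (fun θ => (mul_pos (Real.exp_pos _) (gp_wJ_re_pos J θ)).le) hint]
    have hsupp : Function.support (fun θ : TorusSite 3 L → ℝ => Real.exp (t * ((∑ x : TorusSite 3 L, ∑ y : TorusSite 3 L,
        Real.cos (θ x - θ y)) / (L : ℝ) ^ 3)) * (wJ J θ).re) = Set.univ :=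
      Set.eq_univ_of_forall fun θ => (mul_pos (Real.exp_pos _) (gp_wJ_re_pos J θ)).ne'
    rw [hsupp, Measure.restrict_apply_univ]
    exact volume_cube_pos
  have hZs_ne : ∀ s : ℂ, ‖s‖ ≤ ε → Zs s ≠ 0 := fun s hs => h J hJJ₀ L hL2 s hs
  have hZs_diff : Differentiable ℂ Zs := by
    haveI := ent_isFiniteMeasure_restrict_cube (L := L)
    have hW : Continuous fun θ : TorusSite 3 L → ℝ => (∑ x : TorusSite 3 L, ∑ y : TorusSite 3 L,
        (Real.cos (θ x - θ y) : ℂ)) / (L : ℂ) ^ 3 := by fun_prop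
    exact ent_differentiable_integral_mul_cexp (μ := volume.restrict (cube L))
      (ent_continuous_wJ J).aestronglyMeasurable hW.aestronglyMeasurable (ent_norm_wJ_le J)
      (fun θ => gp_norm_source_le θ)
  have hZs_norm : ∀ s : ℂ, ‖Zs s‖ ≤ Real.exp (‖s‖ * N) * Z₀ := fun s => gp_norm_Zmf_le J s
  -- the symmetrised normalised function `G`
  set G : ℂ → ℂ := fun s => Zs s * Zs (-s) / Zs 0 ^ 2 with hG
  have hGd : DifferentiableOn ℂ G (ball 0 ε) :=
    ((hZs_diff.mul (hZs_diff.comp differentiable_neg)).div_const (Zs 0 ^ 2)).differentiableOn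
  have hG0 : ∀ z ∈ ball (0 : ℂ) ε, G z ≠ 0 := by
    intro z hz
    rw [mem_ball_zero_iff] at hz
    refine div_ne_zero (mul_ne_zero (hZs_ne z hz.le) (hZs_ne (-z) (by rw [norm_neg]; exact hz.le))) (pow_ne_zero _ hZs0_ne)
  have hG1 : G 0 = 1 := by
    simp only [hG, neg_zero]
    rw [pow_two, div_self (mul_ne_zero hZs0_ne hZs0_ne)]
  have hnormZs0 : ‖Zs 0‖ = Z₀ := by rw [hZs0, Complex.norm_real, Real.norm_eq_abs, abs_of_pos hZ₀pos]
  have hGbd : ∀ z ∈ ball (0 : ℂ) ε, ‖G z‖ ≤ Real.exp (2 * N * ε) := by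
    intro z hz
    rw [mem_ball_zero_iff] at hz
    simp only [hG]
    rw [norm_div, norm_mul, norm_pow, hnormZs0, div_le_iff₀ (by positivity)]
    have h1 := hZs_norm z
    have h2 := hZs_norm (-z)
    rw [norm_neg] at h2
    have h3 : Real.exp (‖z‖ * N) ≤ Real.exp (ε * N) :=
      Real.exp_le_exp.2 (mul_le_mul_of_nonneg_right hz.le hNpos.le)
    calc ‖Zs z‖ * ‖Zs (-z)‖ ≤ (Real.exp (‖z‖ * N) * Z₀) * (Real.exp (‖z‖ * N) * Z₀) :=
          mul_le_mul h1 h2 (norm_nonneg _) (by positivity)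
      _ ≤ (Real.exp (ε * N) * Z₀) * (Real.exp (ε * N) * Z₀) := by gcongr
      _ = Real.exp (2 * N * ε) * Z₀ ^ 2 := by
          rw [show 2 * N * ε = ε * N + ε * N by ring, Real.exp_add]; ring
  have hGeven : ∀ z, G (-z) = G z := by
    intro z; simp only [hG, neg_neg]; ring
  have hGder : deriv G 0 = 0 := cfp_deriv_zero_of_even hGeven
  -- the pinch point `σ = a₀ ε / 64`
  set σ : ℝ := a₀ * ε / 64 with hσ
  have hσpos : 0 < σ := by positivity
  have hσε : σ < ε / 2 := by rw [hσ]; nlinarith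
  -- upper bound from zero-freeness
  have hup : Real.log ‖G σ‖ ≤ 8 * (2 * N * ε) / ε ^ 2 * ‖(σ : ℂ)‖ ^ 2 :=
    cfp_log_norm_le_of_zeroFree hε (by positivity) hGd hG0 hG1 hGbd hGder
      (by rw [Complex.norm_real, Real.norm_eq_abs, abs_of_pos hσpos]; exact hσε)
  rw [Complex.norm_real, Real.norm_eq_abs, abs_of_pos hσpos] at hup
  -- the value `‖G σ‖ = (Z(σ)/Z₀) (Z(−σ)/Z₀)`
  have hGσ : ‖G σ‖ = (Zr σ / Z₀) * (Zr (-σ) / Z₀) := by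
    simp only [hG]
    have e1 : Zs (σ : ℂ) = ((Zr σ : ℝ) : ℂ) := hreal σ
    have e2 : Zs (-(σ : ℂ)) = ((Zr (-σ) : ℝ) : ℂ) := by rw [← Complex.ofReal_neg]; exact hreal (-σ)
    rw [e1, e2, hZs0, ← Complex.ofReal_mul, ← Complex.ofReal_pow, ← Complex.ofReal_div, Complex.norm_real,
      Real.norm_eq_abs, abs_of_pos (div_pos (mul_pos (hZrpos σ) (hZrpos (-σ))) (pow_pos hZ₀pos 2))]
    field_simp
  -- lower bounds from long-range order and from the twisted states
  have hlow1 : σ * N * a₀ ≤ Real.log (Zr σ / Z₀) := by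
    have h1 := gp_meanField_lower_pos (L := L) J σ
    have h2 : σ * N * a₀ ≤ σ * (L : ℝ) ^ 3 * (cratio L J (0 : Bond L → Bond L → ℂ)).re := by
      rw [hN]; exact mul_le_mul_of_nonneg_left hpl (by positivity)
    exact h2.trans h1
  have hlow2 : -(σ * N / m) - 2 * Real.pi ^ 2 * (m : ℝ) ^ 2 * J * L ≤ Real.log (Zr (-σ) / Z₀) :=
    gp_meanField_lower_neg (L := L) hL2 hJ0 hσpos.le hm1 hmL
  have hlog : Real.log ‖G σ‖ = Real.log (Zr σ / Z₀) + Real.log (Zr (-σ) / Z₀) := by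
    rw [hGσ, Real.log_mul (div_pos (hZrpos σ) hZ₀pos).ne' (div_pos (hZrpos (-σ)) hZ₀pos).ne']
  -- combine
  have hkey : σ * N * a₀ - σ * N / m - 2 * Real.pi ^ 2 * (m : ℝ) ^ 2 * J * L ≤ 8 * (2 * N * ε) / ε ^ 2 * σ ^ 2 := by
    linarith
  have hmi : σ * N / m ≤ σ * N * a₀ / 2 := by
    rw [div_le_iff₀ hm0]
    have : 2 ≤ a₀ * m := by rwa [div_le_iff₀ ha₀, mul_comm] at hma
    nlinarith [mul_pos hσpos hNpos]
  have hε0 : ε ≠ 0 := hε.ne'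
  have hkey2 : σ * N * a₀ / 2 - 2 * Real.pi ^ 2 * (m : ℝ) ^ 2 * J * L ≤ 16 * N * σ ^ 2 / ε := by
    have : 8 * (2 * N * ε) / ε ^ 2 * σ ^ 2 = 16 * N * σ ^ 2 / ε := by
      field_simp
      ring
    linarith
  -- with `σ = a₀ ε/64`: `N a₀² ε / 256 ≤ 2π² m² J L`, i.e. `L² ≤ B`
  have e1 : σ * N * a₀ / 2 = a₀ ^ 2 * ε * N / 128 := by rw [hσ]; ring
  have e2 : 16 * N * σ ^ 2 / ε = a₀ ^ 2 * ε * N / 256 := by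
    rw [hσ]
    field_simp
    ring
  rw [e1, e2] at hkey2
  have h3 : a₀ ^ 2 * ε * N / 256 ≤ 2 * Real.pi ^ 2 * (m : ℝ) ^ 2 * J * L := by linarith
  have hL0 : (0 : ℝ) < L := by positivity
  have h4 : a₀ ^ 2 * ε * (L : ℝ) ^ 2 / 256 ≤ 2 * Real.pi ^ 2 * (m : ℝ) ^ 2 * J := by
    have h5 : (a₀ ^ 2 * ε * (L : ℝ) ^ 2 / 256) * L ≤ (2 * Real.pi ^ 2 * (m : ℝ) ^ 2 * J) * L := by
      have e3 : (a₀ ^ 2 * ε * (L : ℝ) ^ 2 / 256) * L = a₀ ^ 2 * ε * N / 256 := by rw [hN]; ring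
      rw [e3]
      linarith
    exact le_of_mul_le_mul_right h5 hL0
  have hfin : (L : ℝ) ^ 2 ≤ B := by
    rw [hB, le_div_iff₀ (by positivity)]
    linarith
  linarith

/-- **The invariant mean-field source is not uniformly zero-free** — the same statement under its natural name (alias of the registered
stub `stub_invariantMeanFieldPinching`). -/
theorem perturbedXYOrder_false_for_invariant_meanField_source :
    ¬ (∃ J₀ ε : ℝ, 0 < ε ∧ ∀ J : ℝ, J₀ ≤ J → ∀ (L : ℕ) [NeZero L], 2 ≤ L →
        ∀ s : ℂ, ‖s‖ ≤ ε →
          (∫ θ in cube L, wJ J θ * Complex.exp (s * ((∑ x : TorusSite 3 L, ∑ y : TorusSite 3 L,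
            (Real.cos (θ x - θ y) : ℂ)) / (L : ℂ) ^ 3))) ≠ 0) :=
  stub_invariantMeanFieldPinching

end Summit.HubbardSuperconductivity.HubbardSuperconductivity.Theorems.PerturbedXYOrder

end
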